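import Literature.NumberTheory.EllipticCurves.TwoIsogenySelmerGroupSha
import Literature.NumberTheory.EllipticCurves.TwoDescentOneRootParity
import HarnessLib

/-!
# The Selmer group of the descent via `2`-isogeny over a NUMBER FIELD: local conditions at all places,
# `Ξ⁻¹(Ш(V/K)) ⊆ K(S, 2)`, and the criterion for `Ш(V/K)[φ] = 0`
# (Silverman, *AEC*, Thm. X.4.2(a), Prop. X.4.9, Cor. X.4.4 — over a general number field `K`)

Sequel of `TwoIsogenySelmerGroupSha.lean`, whose §"`Ξ[q] ∈ Ш` iff local conditions" is written over `ℚ` (primes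
`p` and `ℝ`). For a complete `2`-isogeny descent over a number field `K ≠ ℚ` (e.g. over the cubic `2`-division
field of a curve `E/ℚ` without rational `2`-torsion, where `E_K` acquires the `2`-isogeny `φ` with kernel `{O, T}`)
the same statements are needed with the completions `K_v = v.adicCompletion K` (`v` a finite place of `𝓞 K`) and
`K_w = w.Completion` (`w` an infinite place), which is how the tree's `Ш(V/K)` is defined (`WeierstrassCurve.sha`).
Everything here is PROVED; no definitions, no named facts.

* §1 `Valuation.two_dvd_log_of_twoTorsionNF_equation`, `WeierstrassCurve.two_dvd_log_of_xSqClass_eq_sqClass` —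
  **`ord_v α(P)` is even** for a `ℤᵐ⁰`-valued valuation `v` on any field `L` and `W : y² = x³ + ax² + bx` over `L`
  with `v(a) ≤ 1`, `v(b) = v(2) = 1` (Silverman–Tate Prop. 3.8(c) read `v`-adically; the case `θ = 0` of the tree's
  one-root parity lemma `Valuation.two_dvd_log_map_sub_of_mul_quadratic_eq_sq`).
* §2 `WeierstrassCurve.two_dvd_log_valuation_of_sqClass_mem_range_adicCompletion` — the same at a finite place `v` of a
  number field `K`: if `[q]_{K_v} ∈ α(W(K_v))` and `v(a) ≤ 1`, `v(b) = v(2) = 1`, then `ord_v(q)` is even.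
* §3 `WeierstrassCurve.twoIsogenyTorsorHom_sqClass_mem_sha_iff_local` — **`Ξ[q] ∈ Ш(V/K)` iff `[q]_{K_v} ∈ α(V'(K_v))`
  for every finite `v` and `[q]_{K_w} ∈ α(V'(K_w))` for every infinite `w`** (`V' = V.twoIsogenyCodomain`): the Selmer
  group `S^{(φ)}(V/K) = {ξ : res_v ξ = 0 ∀ v}` of *AEC* X.4.2 made explicit by X.4.9, over `K`.
* §4 `WeierstrassCurve.mk_mem_selmerGroup_of_twoIsogenyTorsorHom_mem_sha` — **`Ξ⁻¹(Ш(V/K)) ⊆ K(S, 2)`** for every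
  set `S` of finite places containing those where `a'`, `b'` (the coefficients of `V'`) or `2` are not units
  (*AEC* Cor. X.4.4 / proof of X.4.9: the Selmer group lies in `K(S, 2)`; Mathlib's `IsDedekindDomain.selmerGroup`).
* §5 `WeierstrassCurve.sha_inf_range_twoIsogenyTorsorHom_eq_bot_of_local` — **the assembly criterion**: if every
  `q ∈ K*` whose class lies in `K(S, 2)` and satisfies all local conditions has `[q] ∈ α(V'(K))`, then
  `Ш(V/K) ∩ im Ξ = ⊥`, i.e. `Ш(V/K)[φ] = 0` — the input of `TwoIsogenyShaTwoTorsion.lean`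
  (`eq_zero_of_mem_sha_of_two_smul_eq_zero`: with the same for `V'`, `Ш(V/K)[2] = 0`).

## References
* [SilvermanAEC2009] J. H. Silverman, *The Arithmetic of Elliptic Curves*, 2nd ed. (2009), Thm. X.4.2(a), Cor. X.4.4,
  Prop. X.4.9 (and Remark X.4.7).
* [SilvermanTate2015] J. H. Silverman, J. Tate, *Rational Points on Elliptic Curves*, 2nd ed. (2015), §3.5 Prop. 3.8(c).

## Design
Theorems only; the conventions of `TwoIsogenySelmerGroupSha.lean` (`K : Type u`, `open scoped Classical`, dot-notation
extensions in `namespace WeierstrassCurve`, the `SqUnits`/`sqClass`/`xSqClass` currency, `K⟮S, 2⟯ ⊆ Kˣ/Kˣ²` literally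
the ambient group of `sqClass`). `CharZero` instances on completions are introduced inside proofs from the injective
`algebraMap K K_v`.
-/

noncomputable section

open scoped Classical NumberField

universe u

/-! ## §1 Local parity for one valuation -/

namespace Valuation

open _root_.WeierstrassCurve.Affine

variable {L : Type*} [Field L] (v : Valuation L (WithZero (Multiplicative ℤ)))

/-- **`ord_v(x)` is even on `y² = x³ + ax² + bx` away from `2b`**: for a `ℤᵐ⁰`-valued valuation `v` with `v(a) ≤ 1`,
`v(b) = 1`, `v(2) = 1` and a solution with `x ≠ 0`, `log v(x)` is even (the case `θ = 0`, `B₂ = 4a`, `B₄ = 2b`,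
`z = 2y` of `two_dvd_log_map_sub_of_mul_quadratic_eq_sq`: `x · (4x² + 4ax + 4b) = (2y)²`).
[cite: SilvermanTate2015, §3.5 Prop. 3.8(c)] -/
theorem two_dvd_log_of_twoTorsionNF_equation {a b x y : L} (ha : v a ≤ 1) (hb : v b = 1) (h2 : v 2 = 1)
    (he : y ^ 2 = x ^ 3 + a * x ^ 2 + b * x) (hx : x ≠ 0) : (2 : ℤ) ∣ WithZero.log (v x) := by
  have h20 : (2 : L) ≠ 0 := fun h => by rw [h, map_zero] at h2; exact zero_ne_one h2
  have h4 : v 4 = 1 := by rw [show (4 : L) = 2 * 2 by norm_num, map_mul, h2, one_mul]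
  have hc : v (3 * (0 : L) ^ 2 + 4 * a / 2 * 0 + 2 * b / 2) = 1 := by
    have e : (3 * (0 : L) ^ 2 + 4 * a / 2 * 0 + 2 * b / 2) = b := by field_simp; ring
    rw [e, hb]
  have key := v.two_dvd_log_map_sub_of_mul_quadratic_eq_sq (θ := 0) (B₂ := 4 * a) (B₄ := 2 * b) (x := x)
    (z := 2 * y) (by rw [map_zero]; exact zero_le_one) (by rw [map_mul, h4, one_mul]; exact ha)
    (by rw [map_mul, h2, one_mul]; exact hb.le) h2 hc hx (by linear_combination (-4 : L) * he)
  rwa [sub_zero] at key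

end Valuation

namespace WeierstrassCurve

open _root_.WeierstrassCurve.Affine
open Literature.NumberTheory.EllipticCurves

section Local

variable {L : Type*} [Field L] (v : Valuation L (WithZero (Multiplicative ℤ))) (W : WeierstrassCurve L)
  [W.IsTwoTorsionNF]

/-- **Classes in `α(W(L))` have even order at `v`** when `v(a₂) ≤ 1`, `v(a₄) = 1`, `v(2) = 1`: if `α(P) = [q]` with
`q ≠ 0` then `log v(q)` is even (`α(O) = 1`, `α(T) = [a₄]` a unit, `α(x, y) = [x]` with `ord_v x` even, and classes
with square quotient have orders of the same parity). [cite: SilvermanTate2015, §3.5 Prop. 3.8(c)] -/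
theorem two_dvd_log_of_xSqClass_eq_sqClass (ha : v W.a₂ ≤ 1) (hb : v W.a₄ = 1) (h2 : v 2 = 1) {q : L} (hq : q ≠ 0)
    {P : W.toAffine.Point} (hP : W.xSqClass P = sqClass q) : (2 : ℤ) ∣ WithZero.log (v q) := by
  -- from `e · q = c²` with `log v(e)` even, `log v(q)` is even
  have key : ∀ {e : L}, e ≠ 0 → (2 : ℤ) ∣ WithZero.log (v e) → sqClass e = sqClass q →
      (2 : ℤ) ∣ WithZero.log (v q) := by
    intro e he hev h
    have h1 : sqClass (e * q) = 1 := by rw [sqClass_mul he hq, h, SqUnits.mul_self]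
    obtain ⟨c, hc⟩ := (sqClass_eq_one_iff (mul_ne_zero he hq)).mp h1
    have hc0 : c ≠ 0 := by rintro rfl; exact mul_ne_zero he hq (by rw [hc]; ring)
    have hlog := congrArg (fun t => WithZero.log (v t)) hc
    rw [map_mul, map_pow, WithZero.log_mul ((v.ne_zero_iff).mpr he) ((v.ne_zero_iff).mpr hq), WithZero.log_pow,
      nsmul_eq_mul] at hlog
    push_cast at hlog
    obtain ⟨k, hk⟩ := hev
    exact ⟨WithZero.log (v c) - k, by linarith⟩
  rcases P with _ | ⟨x, y, hxy⟩
  · rw [← Affine.Point.zero_def, xSqClass_zero] at hP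
    have h11 : sqClass (1 : L) = 1 := (sqClass_eq_one_iff one_ne_zero).mpr ⟨1, by ring⟩
    exact key one_ne_zero (by rw [map_one, WithZero.log_one]; exact dvd_zero 2) (h11.trans hP)
  · by_cases hx : x = 0
    · rw [xSqClass_some_of_eq_zero hxy hx] at hP
      have hb0 : W.a₄ ≠ 0 := fun h => by rw [h, map_zero] at hb; exact zero_ne_one hb
      exact key hb0 (by rw [hb, WithZero.log_one]; exact dvd_zero 2) hP
    · rw [xSqClass_some_of_ne_zero hxy hx] at hP
      exact key hx (v.two_dvd_log_of_twoTorsionNF_equation ha hb h2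
        ((W.equation_iff_of_isTwoTorsionNF x y).mp hxy.1) hx) hP

end Local

/-! ## §2 At a finite place of a number field -/

section NumberField

open IsDedekindDomain NumberField

variable {K : Type u} [Field K] [NumberField K]

/-- **`[q]_{K_v} ∈ α(W(K_v))` forces `ord_v(q)` even** at a finite place `v` of `K` with `v(a₂) ≤ 1`, `v(a₄) = 1`,
`v(2) = 1` (`W` over `K` in two-torsion normal form, `K_v = v.adicCompletion K`, whose valuation restricts to `v`).
[cite: SilvermanAEC2009, Cor. X.4.4] -/
theorem two_dvd_log_valuation_of_sqClass_mem_range_adicCompletion (W : WeierstrassCurve K) [W.IsTwoTorsionNF]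
    (v : HeightOneSpectrum (𝓞 K)) (ha : v.valuation K W.a₂ ≤ 1) (hb : v.valuation K W.a₄ = 1)
    (h2 : v.valuation K 2 = 1) {q : K} (hq : q ≠ 0)
    (h : sqClass (algebraMap K (v.adicCompletion K) q) ∈ Set.range (W.baseChange (v.adicCompletion K)).xSqClass) :
    (2 : ℤ) ∣ WithZero.log (v.valuation K q) := by
  have hval : ∀ x : K, Valued.v (algebraMap K (v.adicCompletion K) x) = v.valuation K x := fun x =>
    HeightOneSpectrum.valuedAdicCompletion_eq_valuation' v x
  obtain ⟨P, hP⟩ := h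
  have hq' : algebraMap K (v.adicCompletion K) q ≠ 0 := (map_ne_zero _).mpr hq
  have key := (W.baseChange (v.adicCompletion K)).two_dvd_log_of_xSqClass_eq_sqClass Valued.v
    (by rw [show (W.baseChange (v.adicCompletion K)).a₂ = algebraMap K _ W.a₂ from rfl, hval]; exact ha)
    (by rw [show (W.baseChange (v.adicCompletion K)).a₄ = algebraMap K _ W.a₄ from rfl, hval]; exact hb)
    (by rw [← map_ofNat (algebraMap K (v.adicCompletion K)) 2, hval]; exact h2) hq' hP
  rwa [hval] at key

variable (V : WeierstrassCurve K) [V.IsTwoTorsionNF] [V.IsElliptic]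

/-! ## §3 `Ξ[q] ∈ Ш(V/K)` iff the local conditions hold at every place -/

/-- **The local conditions of `Ξ⁻¹(Ш(V/K))` over a number field.** For `V/K` in two-torsion normal form and
`q ∈ K*`: `Ξ[q] ∈ Ш(V/K)` iff `[q]_{K_v} ∈ α(V'(K_v))` for every finite place `v` and `[q]_{K_w} ∈ α(V'(K_w))` for
every infinite place `w` (`V' = V.twoIsogenyCodomain`; `Ш` is cut out by all completions, and at a completion the
vanishing of `res ξ_q` is `[q] ∈ α(V')` there, `twoIsogenyTorsorClass_mem_localRestrictionKer_iff_sqClass`).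
[cite: SilvermanAEC2009, Thm. X.4.2(a) and Prop. X.4.9] -/
theorem twoIsogenyTorsorHom_sqClass_mem_sha_iff_local {q : K} (hq : q ≠ 0) :
    V.twoIsogenyTorsorHom (Additive.ofMul (sqClass q)) ∈ V.sha ↔
      (∀ v : HeightOneSpectrum (𝓞 K), sqClass (algebraMap K (v.adicCompletion K) q) ∈
          Set.range (V.twoIsogenyCodomain.baseChange (v.adicCompletion K)).xSqClass) ∧
        ∀ w : InfinitePlace K, sqClass (algebraMap K w.Completion q) ∈
          Set.range (V.twoIsogenyCodomain.baseChange w.Completion).xSqClass := by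
  rw [twoIsogenyTorsorHom_sqClass V hq, mem_sha_iff]
  have hloc : ∀ (F : Type u) [Field F] [Algebra K F], V.twoIsogenyTorsorClass hq ∈ V.localRestrictionKer F ↔
      sqClass (algebraMap K F q) ∈ Set.range (V.twoIsogenyCodomain.baseChange F).xSqClass := by
    intro F _ _
    haveI : CharZero F := charZero_of_injective_algebraMap (algebraMap K F).injective
    exact twoIsogenyTorsorClass_mem_localRestrictionKer_iff_sqClass V F hq
  simp only [hloc]

/-! ## §4 `Ξ⁻¹(Ш(V/K)) ⊆ K(S, 2)` -/

/-- **The Selmer group of the `2`-isogeny lies in `K(S, 2)`**: if `Ξ[q] ∈ Ш(V/K)` then the class of `q` lies in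
Mathlib's `K⟮S, 2⟯` for every set `S` of finite places outside which `a'` is integral and `b'`, `2` are units
(`V' : y² = x³ + a'x² + b'x`): at `v ∉ S` the local condition gives `ord_v(q)` even (§2).
[cite: SilvermanAEC2009, Cor. X.4.4] -/
theorem mk_mem_selmerGroup_of_twoIsogenyTorsorHom_mem_sha {S : Set (HeightOneSpectrum (𝓞 K))}
    (hS : ∀ v ∉ S, v.valuation K V.twoIsogenyCodomain.a₂ ≤ 1 ∧ v.valuation K V.twoIsogenyCodomain.a₄ = 1 ∧
      v.valuation K 2 = 1)
    {q : K} (hq : q ≠ 0) (h : V.twoIsogenyTorsorHom (Additive.ofMul (sqClass q)) ∈ V.sha) :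
    (QuotientGroup.mk (Units.mk0 q hq) : Kˣ ⧸ (powMonoidHom 2 : Kˣ →* Kˣ).range) ∈
      IsDedekindDomain.selmerGroup (R := 𝓞 K) (K := K) (S := S) (n := 2) := by
  rw [IsDedekindDomain.mk_mem_selmerGroup_iff]
  intro v hv
  obtain ⟨ha, hb, h2⟩ := hS v hv
  rw [Units.val_mk0]
  exact V.twoIsogenyCodomain.two_dvd_log_valuation_of_sqClass_mem_range_adicCompletion v ha hb h2 hq
    (((V.twoIsogenyTorsorHom_sqClass_mem_sha_iff_local hq).mp h).1 v)

/-! ## §5 The criterion for `Ш(V/K)[φ] = 0` -/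

omit [NumberField K] in
/-- Every element of `Kˣ/Kˣ²` is the square class of a non-zero element of `K`. [folklore] -/
private theorem exists_sqClass_eq (x : SqUnits K) : ∃ q : K, ∃ _ : q ≠ 0, sqClass q = x := by
  induction x using QuotientGroup.induction_on with
  | H u => exact ⟨(u : K), u.ne_zero, by rw [sqClass_of_ne_zero u.ne_zero, Units.mk0_val]⟩

/-- **Criterion for `Ш(V/K) ∩ im Ξ = ⊥` (`Ш(V/K)[φ] = 0`).** If every `q ∈ K*` whose class lies in `K⟮S, 2⟯` (`S` as
in §4) and which satisfies the local conditions at all places has `[q] ∈ α(V'(K))`, then no non-zero class of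
`im Ξ` lies in `Ш(V/K)` (`ξ_q = 0 ↔ [q] ∈ α(V'(K))`, `twoIsogenyTorsorClass_eq_zero_iff`). This is the form in which a
complete `2`-isogeny descent over `K` is assembled: enumerate `K(S, 2)`, and for each class exhibit a `K`-point of
`V'` or a place where the local condition fails. [cite: SilvermanAEC2009, Thm. X.4.2(a) and Prop. X.4.9] -/
theorem sha_inf_range_twoIsogenyTorsorHom_eq_bot_of_local {S : Set (HeightOneSpectrum (𝓞 K))}
    (hS : ∀ v ∉ S, v.valuation K V.twoIsogenyCodomain.a₂ ≤ 1 ∧ v.valuation K V.twoIsogenyCodomain.a₄ = 1 ∧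
      v.valuation K 2 = 1)
    (h : ∀ (q : K) (hq : q ≠ 0),
      (QuotientGroup.mk (Units.mk0 q hq) : Kˣ ⧸ (powMonoidHom 2 : Kˣ →* Kˣ).range) ∈
          IsDedekindDomain.selmerGroup (R := 𝓞 K) (K := K) (S := S) (n := 2) →
      (∀ v : HeightOneSpectrum (𝓞 K), sqClass (algebraMap K (v.adicCompletion K) q) ∈
          Set.range (V.twoIsogenyCodomain.baseChange (v.adicCompletion K)).xSqClass) →
      (∀ w : InfinitePlace K, sqClass (algebraMap K w.Completion q) ∈
          Set.range (V.twoIsogenyCodomain.baseChange w.Completion).xSqClass) →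
      sqClass q ∈ Set.range V.twoIsogenyCodomain.xSqClass) :
    V.sha ⊓ AddMonoidHom.range (G := Additive (SqUnits K)) V.twoIsogenyTorsorHom = ⊥ := by
  refine (AddSubgroup.eq_bot_iff_forall _).mpr fun c hc => ?_
  obtain ⟨hsha, ⟨x, rfl⟩⟩ := AddSubgroup.mem_inf.mp hc
  obtain ⟨q, hq, hx⟩ := exists_sqClass_eq (Additive.toMul x)
  have hx' : x = Additive.ofMul (sqClass q) := by rw [hx]; rfl
  subst hx'
  obtain ⟨hfin, hinf⟩ := (V.twoIsogenyTorsorHom_sqClass_mem_sha_iff_local hq).mp hsha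
  have hsel := V.mk_mem_selmerGroup_of_twoIsogenyTorsorHom_mem_sha hS hq hsha
  rw [twoIsogenyTorsorHom_sqClass V hq, twoIsogenyTorsorClass_eq_zero_iff]
  exact h q hq hsel hfin hinf

/-- **`Ш(V/K)[φ] = 0` from the local criterion, pointwise form**: under the hypotheses of
`sha_inf_range_twoIsogenyTorsorHom_eq_bot_of_local`, `Ξ[q] ∈ Ш(V/K) ⇒ Ξ[q] = 0` for every `q ∈ K`.
[cite: SilvermanAEC2009, Thm. X.4.2(a) and Prop. X.4.9] -/
theorem twoIsogenyTorsorHom_eq_zero_of_mem_sha_of_local {S : Set (HeightOneSpectrum (𝓞 K))}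
    (hS : ∀ v ∉ S, v.valuation K V.twoIsogenyCodomain.a₂ ≤ 1 ∧ v.valuation K V.twoIsogenyCodomain.a₄ = 1 ∧
      v.valuation K 2 = 1)
    (h : ∀ (q : K) (hq : q ≠ 0),
      (QuotientGroup.mk (Units.mk0 q hq) : Kˣ ⧸ (powMonoidHom 2 : Kˣ →* Kˣ).range) ∈
          IsDedekindDomain.selmerGroup (R := 𝓞 K) (K := K) (S := S) (n := 2) →
      (∀ v : HeightOneSpectrum (𝓞 K), sqClass (algebraMap K (v.adicCompletion K) q) ∈
          Set.range (V.twoIsogenyCodomain.baseChange (v.adicCompletion K)).xSqClass) →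
      (∀ w : InfinitePlace K, sqClass (algebraMap K w.Completion q) ∈
          Set.range (V.twoIsogenyCodomain.baseChange w.Completion).xSqClass) →
      sqClass q ∈ Set.range V.twoIsogenyCodomain.xSqClass)
    {q : K} (hsha : V.twoIsogenyTorsorHom (Additive.ofMul (sqClass q)) ∈ V.sha) :
    V.twoIsogenyTorsorHom (Additive.ofMul (sqClass q)) = 0 := by
  have hbot := V.sha_inf_range_twoIsogenyTorsorHom_eq_bot_of_local hS h
  exact (AddSubgroup.eq_bot_iff_forall _).mp hbot _ (AddSubgroup.mem_inf.mpr ⟨hsha, ⟨_, rfl⟩⟩)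

end NumberField

end WeierstrassCurve


/-! ## §6 The dyadic-free form: `v(2) = 1` is not needed

The parity of `ord_v α(P)` only uses `v(a) ≤ 1` and `v(b) = 1` (Silverman–Tate's argument: for `v(x) < 1` the factor
`x² + ax + b` is a unit, for `v(x) > 1` it has valuation `v(x)²`), so the places above `2` need not be put into `S`
when `b` is a unit there. The primed statements below sharpen §1, §2, §4, §5 accordingly (the unprimed ones, derived
from the one-root lemma whose complementary quadratic carries a factor `4`, keep the hypothesis `v(2) = 1`). -/

namespace Valuation

variable {L : Type*} [Field L] (v : Valuation L (WithZero (Multiplicative ℤ)))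

/-- **`ord_v(x)` is even on `y² = x³ + ax² + bx` whenever `v(a) ≤ 1`, `v(b) = 1`** (no condition on `v(2)`): if
`v(x) < 1` then `v(x² + ax + b) = 1` and `v(y)² = v(x)`; if `v(x) > 1` then, with `t = x⁻¹`,
`(yt²)² = t(1 + at + bt²)` and `v(1 + at + bt²) = 1`. [cite: SilvermanTate2015, §3.5 Prop. 3.8(c)] -/
theorem two_dvd_log_of_twoTorsionNF_equation' {a b x y : L} (ha : v a ≤ 1) (hb : v b = 1)
    (he : y ^ 2 = x ^ 3 + a * x ^ 2 + b * x) (hx : x ≠ 0) : (2 : ℤ) ∣ WithZero.log (v x) := by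
  rcases lt_trichotomy (v x) 1 with hlt | heq | hgt
  · -- `v x < 1`: `v(x² + ax) < 1 = v b`, so `v(x² + ax + b) = 1` and `v(y)² = v(x)`
    have h1 : v (x ^ 2 + a * x) < 1 := by
      refine lt_of_le_of_lt (v.map_add _ _) (max_lt ?_ ?_)
      · rw [map_pow]; exact pow_lt_one₀ zero_le hlt two_ne_zero
      · rw [map_mul]
        calc v a * v x ≤ 1 * v x := by gcongr
          _ = v x := one_mul _
          _ < 1 := hlt
    have hq : v (x ^ 2 + a * x + b) = 1 := by
      rw [v.map_add_eq_of_lt_right (by rwa [hb]), hb]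
    have key : v y ^ 2 = v x := by
      rw [← map_pow, show y ^ 2 = x * (x ^ 2 + a * x + b) by linear_combination he, map_mul, hq, mul_one]
    have hlog := congrArg WithZero.log key
    rw [WithZero.log_pow, nsmul_eq_mul] at hlog
    push_cast at hlog
    exact ⟨WithZero.log (v y), by linarith⟩
  · rw [heq, WithZero.log_one]; exact dvd_zero 2
  · -- `v x > 1`: with `t = x⁻¹`, `(y t²)² = t (1 + at + bt²)` and `v(1 + at + bt²) = 1`
    set t := x⁻¹ with ht
    have hxt : x * t = 1 := mul_inv_cancel₀ hx
    have hvt : v t < 1 := by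
      rw [ht, map_inv₀]; exact inv_lt_one_of_one_lt₀ hgt
    have h1 : v (a * t + b * t ^ 2) < 1 := by
      refine lt_of_le_of_lt (v.map_add _ _) (max_lt ?_ ?_)
      · rw [map_mul]
        calc v a * v t ≤ 1 * v t := by gcongr
          _ = v t := one_mul _
          _ < 1 := hvt
      · rw [map_mul, map_pow, hb, one_mul]; exact pow_lt_one₀ zero_le hvt two_ne_zero
    have hq : v (1 + (a * t + b * t ^ 2)) = 1 := by
      rw [v.map_add_eq_of_lt_left (by rwa [map_one]), map_one]
    have heq' : (y * t ^ 2) ^ 2 = t * (1 + (a * t + b * t ^ 2)) := by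
      linear_combination t ^ 4 * he + (t * (t ^ 2 * x ^ 2 + t * x + 1) + a * t ^ 2 * (t * x + 1) + b * t ^ 3) * hxt
    have key : v (y * t ^ 2) ^ 2 = v t := by rw [← map_pow, heq', map_mul, hq, mul_one]
    have hlog := congrArg WithZero.log key
    rw [WithZero.log_pow, nsmul_eq_mul] at hlog
    push_cast at hlog
    have hlt : WithZero.log (v t) = - WithZero.log (v x) := by
      rw [ht, map_inv₀, WithZero.log_inv]
    exact ⟨-WithZero.log (v (y * t ^ 2)), by linarith⟩

end Valuation

namespace WeierstrassCurve

open _root_.WeierstrassCurve.Affine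
open Literature.NumberTheory.EllipticCurves

section Local'

variable {L : Type*} [Field L] (v : Valuation L (WithZero (Multiplicative ℤ))) (W : WeierstrassCurve L)
  [W.IsTwoTorsionNF]

/-- **Classes in `α(W(L))` have even order at `v`** when `v(a₂) ≤ 1`, `v(a₄) = 1` (no condition on `v(2)`).
[cite: SilvermanTate2015, §3.5 Prop. 3.8(c)] -/
theorem two_dvd_log_of_xSqClass_eq_sqClass' (ha : v W.a₂ ≤ 1) (hb : v W.a₄ = 1) {q : L} (hq : q ≠ 0)
    {P : W.toAffine.Point} (hP : W.xSqClass P = sqClass q) : (2 : ℤ) ∣ WithZero.log (v q) := by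
  have key : ∀ {e : L}, e ≠ 0 → (2 : ℤ) ∣ WithZero.log (v e) → sqClass e = sqClass q →
      (2 : ℤ) ∣ WithZero.log (v q) := by
    intro e he hev h
    have h1 : sqClass (e * q) = 1 := by rw [sqClass_mul he hq, h, SqUnits.mul_self]
    obtain ⟨c, hc⟩ := (sqClass_eq_one_iff (mul_ne_zero he hq)).mp h1
    have hc0 : c ≠ 0 := by rintro rfl; exact mul_ne_zero he hq (by rw [hc]; ring)
    have hlog := congrArg (fun t => WithZero.log (v t)) hc
    rw [map_mul, map_pow, WithZero.log_mul ((v.ne_zero_iff).mpr he) ((v.ne_zero_iff).mpr hq), WithZero.log_pow,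
      nsmul_eq_mul] at hlog
    push_cast at hlog
    obtain ⟨k, hk⟩ := hev
    exact ⟨WithZero.log (v c) - k, by linarith⟩
  rcases P with _ | ⟨x, y, hxy⟩
  · rw [← Affine.Point.zero_def, xSqClass_zero] at hP
    have h11 : sqClass (1 : L) = 1 := (sqClass_eq_one_iff one_ne_zero).mpr ⟨1, by ring⟩
    exact key one_ne_zero (by rw [map_one, WithZero.log_one]; exact dvd_zero 2) (h11.trans hP)
  · by_cases hx : x = 0
    · rw [xSqClass_some_of_eq_zero hxy hx] at hP
      have hb0 : W.a₄ ≠ 0 := fun h => by rw [h, map_zero] at hb; exact zero_ne_one hb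
      exact key hb0 (by rw [hb, WithZero.log_one]; exact dvd_zero 2) hP
    · rw [xSqClass_some_of_ne_zero hxy hx] at hP
      exact key hx (v.two_dvd_log_of_twoTorsionNF_equation' ha hb
        ((W.equation_iff_of_isTwoTorsionNF x y).mp hxy.1) hx) hP

end Local'

section NumberField'

open IsDedekindDomain NumberField

variable {K : Type u} [Field K] [NumberField K]

/-- **`[q]_{K_v} ∈ α(W(K_v))` forces `ord_v(q)` even** at a finite place `v` with `v(a₂) ≤ 1`, `v(a₄) = 1` — also at
places above `2`. [cite: SilvermanAEC2009, Cor. X.4.4] -/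
theorem two_dvd_log_valuation_of_sqClass_mem_range_adicCompletion' (W : WeierstrassCurve K) [W.IsTwoTorsionNF]
    (v : HeightOneSpectrum (𝓞 K)) (ha : v.valuation K W.a₂ ≤ 1) (hb : v.valuation K W.a₄ = 1) {q : K} (hq : q ≠ 0)
    (h : sqClass (algebraMap K (v.adicCompletion K) q) ∈ Set.range (W.baseChange (v.adicCompletion K)).xSqClass) :
    (2 : ℤ) ∣ WithZero.log (v.valuation K q) := by
  have hval : ∀ x : K, Valued.v (algebraMap K (v.adicCompletion K) x) = v.valuation K x := fun x =>
    HeightOneSpectrum.valuedAdicCompletion_eq_valuation' v x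
  obtain ⟨P, hP⟩ := h
  have hq' : algebraMap K (v.adicCompletion K) q ≠ 0 := (map_ne_zero _).mpr hq
  have key := (W.baseChange (v.adicCompletion K)).two_dvd_log_of_xSqClass_eq_sqClass' Valued.v
    (by rw [show (W.baseChange (v.adicCompletion K)).a₂ = algebraMap K _ W.a₂ from rfl, hval]; exact ha)
    (by rw [show (W.baseChange (v.adicCompletion K)).a₄ = algebraMap K _ W.a₄ from rfl, hval]; exact hb) hq' hP
  rwa [hval] at key

variable (V : WeierstrassCurve K) [V.IsTwoTorsionNF] [V.IsElliptic]

/-- **`Ξ⁻¹(Ш(V/K)) ⊆ K(S, 2)` for every `S` outside which `a'` is integral and `b'` is a unit** (places above `2` with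
`b'` a unit need not be in `S`). [cite: SilvermanAEC2009, Cor. X.4.4] -/
theorem mk_mem_selmerGroup_of_twoIsogenyTorsorHom_mem_sha' {S : Set (HeightOneSpectrum (𝓞 K))}
    (hS : ∀ v ∉ S, v.valuation K V.twoIsogenyCodomain.a₂ ≤ 1 ∧ v.valuation K V.twoIsogenyCodomain.a₄ = 1)
    {q : K} (hq : q ≠ 0) (h : V.twoIsogenyTorsorHom (Additive.ofMul (sqClass q)) ∈ V.sha) :
    (QuotientGroup.mk (Units.mk0 q hq) : Kˣ ⧸ (powMonoidHom 2 : Kˣ →* Kˣ).range) ∈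
      IsDedekindDomain.selmerGroup (R := 𝓞 K) (K := K) (S := S) (n := 2) := by
  rw [IsDedekindDomain.mk_mem_selmerGroup_iff]
  intro v hv
  obtain ⟨ha, hb⟩ := hS v hv
  rw [Units.val_mk0]
  exact V.twoIsogenyCodomain.two_dvd_log_valuation_of_sqClass_mem_range_adicCompletion' v ha hb hq
    (((V.twoIsogenyTorsorHom_sqClass_mem_sha_iff_local hq).mp h).1 v)

/-- **Criterion for `Ш(V/K) ∩ im Ξ = ⊥`, dyadic-free form of `S`**: as `sha_inf_range_twoIsogenyTorsorHom_eq_bot_of_local`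
with `S` only required to contain the places where `a'` is not integral or `b'` is not a unit.
[cite: SilvermanAEC2009, Thm. X.4.2(a) and Prop. X.4.9] -/
theorem sha_inf_range_twoIsogenyTorsorHom_eq_bot_of_local' {S : Set (HeightOneSpectrum (𝓞 K))}
    (hS : ∀ v ∉ S, v.valuation K V.twoIsogenyCodomain.a₂ ≤ 1 ∧ v.valuation K V.twoIsogenyCodomain.a₄ = 1)
    (h : ∀ (q : K) (hq : q ≠ 0),
      (QuotientGroup.mk (Units.mk0 q hq) : Kˣ ⧸ (powMonoidHom 2 : Kˣ →* Kˣ).range) ∈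
          IsDedekindDomain.selmerGroup (R := 𝓞 K) (K := K) (S := S) (n := 2) →
      (∀ v : HeightOneSpectrum (𝓞 K), sqClass (algebraMap K (v.adicCompletion K) q) ∈
          Set.range (V.twoIsogenyCodomain.baseChange (v.adicCompletion K)).xSqClass) →
      (∀ w : InfinitePlace K, sqClass (algebraMap K w.Completion q) ∈
          Set.range (V.twoIsogenyCodomain.baseChange w.Completion).xSqClass) →
      sqClass q ∈ Set.range V.twoIsogenyCodomain.xSqClass) :
    V.sha ⊓ AddMonoidHom.range (G := Additive (SqUnits K)) V.twoIsogenyTorsorHom = ⊥ := by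
  refine (AddSubgroup.eq_bot_iff_forall _).mpr fun c hc => ?_
  obtain ⟨hsha, ⟨x, rfl⟩⟩ := AddSubgroup.mem_inf.mp hc
  obtain ⟨q, hq, hx⟩ := exists_sqClass_eq (Additive.toMul x)
  have hx' : x = Additive.ofMul (sqClass q) := by rw [hx]; rfl
  subst hx'
  obtain ⟨hfin, hinf⟩ := (V.twoIsogenyTorsorHom_sqClass_mem_sha_iff_local hq).mp hsha
  have hsel := V.mk_mem_selmerGroup_of_twoIsogenyTorsorHom_mem_sha' hS hq hsha
  rw [twoIsogenyTorsorHom_sqClass V hq, twoIsogenyTorsorClass_eq_zero_iff]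
  exact h q hq hsel hfin hinf

end NumberField'

end WeierstrassCurve

end
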